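import Literature.Analysis.FluidPDE.ParabolicTenThirds
import Literature.Analysis.FluidPDE.PeriodicWindowIntegral
import HarnessLib

/-!
# The Sobolev step per period: `L⁶` and parabolic `L^{10/3}` bounds on one period slab for
# axially periodic functions

Analysis/FluidPDE proofs file (one auxiliary definition, everything proved, no named facts), on
the discharge path of the named fact `Literature.Analysis.FluidPDE.leiRenZhang2019_liouville_periodic`
(Z. Lei, X. Ren, Q. S. Zhang, *On ancient periodic solutions to axially-symmetric Navier–Stokes
equations*, arXiv:1902.11229 = Math. Ann. 383 (2022), Theorem 1.1). In the Moser iteration of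
their Lemma 2.1 (the local maximum estimate on the periodic domains `P_R = D_R × (−R², 0]`,
`D_R = {r < R} × [0, Z₀)`) the Sobolev embedding is needed **per period**, with a constant that
does not degrade as `R → ∞`; the paper states it as (2.9),
"`‖f‖_{L³(D_1)} ≤ C‖∇f‖_{L²(D_1)}` for any `f` having period `Z₀` in `z` and compactly supported
in the other two dimensions", proved from the whole-space embedding applied to `f g`, `g` a
cut-off equal to `1` on `N` periods and decaying linearly over the next `N` ("Choose a cut-off
function `g(z) = 1` for `0 < z ≤ NZ₀`, `2 − z/(NZ₀)` for `NZ₀ ≤ z < 2NZ₀`", arXiv p. 6), followed by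
"scaling argument on the `x₁` and `x₂` direction".

This file proves the form of that step consumed by the tree's Moser chain (`L⁶` rather than `L³`,
and `L^{10/3}` in space–time, as in `ParabolicTenThirds`), directly at scale and without the
scaling argument:

* `gentleWindow` — a smooth `g₀ : ℝ → [0, 1]`, `= 1` on `[0, 1]`, `= 0` off `(−1, 2)`, with
  bounded derivative (the paper's `g`, smoothed);
* `rpow_third_lintegral_six_slab_le` — **the slab Sobolev inequality**: there is an absolute
  `C₀ > 0` such that for every period `P > 0`, every `M ∈ ℕ`, `M ≥ 1`, and every `C¹`, axially
  `P`-periodic `f` vanishing outside some cylinder `{r < R₀}`,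
  `(∫_{slab} |f|⁶)^{1/3} ≤ 6 C_S² M^{2/3} (∫_{slab} ‖∇f‖² + (C₀/(MP))² ∫_{slab} f²)`,
  `slab = zSlab P 0` one period, `C_S` the constant of `H¹(ℝ³) ⊂ L⁶(ℝ³)`. Proof: the
  whole-space inequality (`eLpNorm_six_le_eLpNorm_fderiv_two`) for `h = f · g₀(z/(MP))`, whose
  `L⁶` norm dominates `M` periods of `f` and whose gradient lives on `3M` periods
  (`IsAxiallyPeriodic.setLIntegral_slabs_eq_mul`), `‖∇h‖² ≤ 2‖∇f‖² + 2 (C₀/(MP))² f²` there.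
  The zeroth-order term is **kept** (no Friedrichs inequality): in the parabolic application the
  time window `R²` and the choice `MP ≥ R` make it harmless.
* `lintegral_rpow_tenThirds_slab_le_of_slice_bounds` — the parabolic interpolation per period:
  for a space–time function with such slices, `∫_{slab} g(s)² ≤ M*` and
  `∫_{slab} ‖∇g(s)‖² + (C₀/(MP))² ∫_{slab} g(s)² ≤ W(s)`,
  `∬ |g|^{10/3} d(ν ⊗ dx|_{slab}) ≤ 6 C_S² M^{2/3} · M*^{2/3} · ∫ W dν`
  (slice interpolation `∫ f^{10/3} ≤ (∫f²)^{2/3}(∫f⁶)^{1/3}` + the slab inequality).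

With `M ≈ R/P` periods the constant `M^{2/3} R^{-10/3} (R⁴)^{2/3}` of the normalised Moser step is
bounded uniformly in `R ≥ P` — this is the "dimension reduction effect" of Lemma 2.1 (the volume of
`P_R` per period is `~R⁴`, not `R⁵`).

## References

* Z. Lei, X. Ren, Q. S. Zhang, arXiv:1902.11229, §2: Lemma 2.1, (2.8)–(2.9) and the cut-off `g`
  (arXiv pp. 5–6). [LeiRenZhang2019]
* Z. Lei, Q. S. Zhang, J. Funct. Anal. 261 (2011) = arXiv:1011.5066, §2 p. 7 (the `L^{10/3}`
  Sobolev step of the Moser iteration, tree `ParabolicTenThirds`). [LeiZhang2011]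
-/

noncomputable section

open MeasureTheory Set Function Filter
open scoped ENNReal NNReal Topology

namespace Literature.Analysis.FluidPDE

/-! ### The gentle axial window -/

/-- The **gentle window** `g₀(s) = smoothTransition(s + 1) · smoothTransition(2 − s)`: a smooth
profile with values in `[0, 1]`, equal to `1` on `[0, 1]` and to `0` off `(−1, 2)` — a smoothed
version of the cut-off "`g(z) = 1` for `0 < z ≤ NZ₀`, `2 − z/(NZ₀)` for `NZ₀ ≤ z < 2NZ₀`, `0`
otherwise" of Lei–Ren–Zhang, used (rescaled to `M` periods) to pass from the whole-space Sobolev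
inequality to one period. [cite: LeiRenZhang2019, §2, proof of (2.9) (the cut-off g, arXiv p. 6)] -/
def gentleWindow (s : ℝ) : ℝ :=
  Real.smoothTransition (s + 1) * Real.smoothTransition (2 - s)

/-- `g₀` is smooth. [folklore] -/
private theorem contDiff_gentleWindow {n : ℕ∞} : ContDiff ℝ n gentleWindow :=
  (Real.smoothTransition.contDiff.comp (contDiff_id.add contDiff_const)).mul
    (Real.smoothTransition.contDiff.comp (contDiff_const.sub contDiff_id))

/-- `0 ≤ g₀`. [folklore] -/
private theorem gentleWindow_nonneg (s : ℝ) : 0 ≤ gentleWindow s :=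
  mul_nonneg (Real.smoothTransition.nonneg _) (Real.smoothTransition.nonneg _)

/-- `g₀ ≤ 1`. [folklore] -/
private theorem gentleWindow_le_one (s : ℝ) : gentleWindow s ≤ 1 :=
  mul_le_one₀ (Real.smoothTransition.le_one _) (Real.smoothTransition.nonneg _)
    (Real.smoothTransition.le_one _)

/-- `g₀ = 1` on `[0, 1]`. [folklore] -/
private theorem gentleWindow_eq_one {s : ℝ} (hs : s ∈ Icc (0 : ℝ) 1) : gentleWindow s = 1 := by
  rw [gentleWindow, Real.smoothTransition.one_of_one_le (by linarith [hs.1]),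
    Real.smoothTransition.one_of_one_le (by linarith [hs.2]), one_mul]

/-- `g₀(s) ≠ 0` forces `s ∈ (−1, 2)`. [folklore] -/
private theorem mem_Ioo_of_gentleWindow_ne_zero {s : ℝ} (hs : gentleWindow s ≠ 0) :
    s ∈ Ioo (-1 : ℝ) 2 := by
  by_contra h
  rw [mem_Ioo, not_and_or, not_lt, not_lt] at h
  apply hs
  rcases h with h | h
  · rw [gentleWindow, Real.smoothTransition.zero_of_nonpos (by linarith), zero_mul]
  · rw [gentleWindow, Real.smoothTransition.zero_of_nonpos (by linarith : 2 - s ≤ 0), mul_zero]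

/-- `g₀` has compact support. [folklore] -/
private theorem hasCompactSupport_gentleWindow : HasCompactSupport gentleWindow :=
  isCompact_Icc.of_isClosed_subset (isClosed_tsupport _)
    (closure_minimal (fun _ hs => Ioo_subset_Icc_self (mem_Ioo_of_gentleWindow_ne_zero hs))
      isClosed_Icc)

/-- At a zero of `g₀` the derivative vanishes (`g₀ ≥ 0`, so every zero is a minimum). [folklore] -/
private theorem deriv_gentleWindow_eq_zero_of_eq_zero {s : ℝ} (hs : gentleWindow s = 0) :
    deriv gentleWindow s = 0 := by
  have hmin : IsLocalMin gentleWindow s :=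
    Filter.Eventually.of_forall fun t => by rw [hs]; exact gentleWindow_nonneg t
  exact hmin.deriv_eq_zero

/-- **A bound for `g₀'`**: there is `C₀ > 0` with `|g₀'| ≤ C₀` (continuity and compact support).
This is the constant through which the axial cut-off enters the slab Sobolev inequality, as
`|∂_z g| ≲ 1/(NZ₀)` in Lei–Ren–Zhang's proof of (2.9). [cite: LeiRenZhang2019, §2, proof of (2.9) (arXiv p. 6)] -/
theorem exists_abs_deriv_gentleWindow_le : ∃ C₀ : ℝ, 0 < C₀ ∧ ∀ s, |deriv gentleWindow s| ≤ C₀ := by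
  have hc : Continuous (deriv gentleWindow) := contDiff_gentleWindow.continuous_deriv le_rfl (n := 1)
  obtain ⟨C, hC⟩ := hasCompactSupport_gentleWindow.deriv.exists_bound_of_continuous hc
  refine ⟨max C 1, by positivity, fun s => ?_⟩
  have h := hC s
  rw [Real.norm_eq_abs] at h
  exact h.trans (le_max_left _ _)

/-! ### Plumbing on `ℝ³` -/

/-- The coordinate `x ↦ x 2` is measurable. [folklore] -/
private theorem measurable_apply_two' : Measurable fun x : EuclideanSpace ℝ (Fin 3) => x 2 :=
  (EuclideanSpace.proj (𝕜 := ℝ) (2 : Fin 3)).continuous.measurable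

/-- `r(x) ≤ ‖x‖`. [folklore] -/
private theorem cylRadius_le_norm' (x : EuclideanSpace ℝ (Fin 3)) : cylRadius x ≤ ‖x‖ := by
  rw [cylRadius, EuclideanSpace.norm_eq]
  apply Real.sqrt_le_sqrt
  simp only [Fin.sum_univ_three, Real.norm_eq_abs, sq_abs]
  nlinarith [sq_nonneg (x 2)]

/-- `|x₂| ≤ ‖x‖`. [folklore] -/
private theorem abs_apply_two_le_norm' (x : EuclideanSpace ℝ (Fin 3)) : |x 2| ≤ ‖x‖ := by
  rw [EuclideanSpace.norm_eq, ← Real.sqrt_sq_eq_abs]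
  apply Real.sqrt_le_sqrt
  simp only [Fin.sum_univ_three, Real.norm_eq_abs, sq_abs]
  nlinarith [sq_nonneg (x 0), sq_nonneg (x 1)]

/-- `‖x‖ ≤ r(x) + |x₂|`. [folklore] -/
private theorem norm_le_cylRadius_add_abs (x : EuclideanSpace ℝ (Fin 3)) :
    ‖x‖ ≤ cylRadius x + |x 2| := by
  have h1 : ‖x‖ ^ 2 = cylRadius x ^ 2 + (x 2) ^ 2 := by
    rw [EuclideanSpace.norm_eq, Real.sq_sqrt (Finset.sum_nonneg fun i _ => sq_nonneg _),
      cylRadius_sq]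
    simp only [Fin.sum_univ_three, Real.norm_eq_abs, sq_abs]
  have h2 : ‖x‖ ^ 2 ≤ (cylRadius x + |x 2|) ^ 2 := by
    rw [h1]
    nlinarith [cylRadius_nonneg x, abs_nonneg (x 2), sq_abs (x 2)]
  exact (pow_le_pow_iff_left₀ (norm_nonneg _)
    (add_nonneg (cylRadius_nonneg x) (abs_nonneg _)) two_ne_zero).1 h2

/-- The derivative of a periodic function is periodic. [folklore] -/
private theorem IsAxiallyPeriodic.fderiv_periodic {P : ℝ} {f : EuclideanSpace ℝ (Fin 3) → ℝ}
    (hf : IsAxiallyPeriodic P f) : IsAxiallyPeriodic P (fderiv ℝ f) := by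
  intro x
  have hfun : (fun y => f (y + P • EuclideanSpace.single (2 : Fin 3) (1 : ℝ))) = f := funext hf
  have h := fderiv_comp_add_right (𝕜 := ℝ) (f := f) (x := x)
    (P • EuclideanSpace.single (2 : Fin 3) (1 : ℝ))
  rw [hfun] at h
  exact h.symm

/-! ### The scaled axial window on `ℝ³` -/

/-- The axial window at scale `L`: `G_L(x) = g₀(x 2 / L)`. [folklore] -/
private def axialWindow (L : ℝ) (x : EuclideanSpace ℝ (Fin 3)) : ℝ := gentleWindow (x 2 / L)

/-- `G_L` is `C¹` (indeed smooth). [folklore] -/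
private theorem contDiff_axialWindow (L : ℝ) {n : ℕ∞} : ContDiff ℝ n (axialWindow L) :=
  contDiff_gentleWindow.comp
    (((EuclideanSpace.proj (𝕜 := ℝ) (2 : Fin 3)).contDiff).div_const L)

/-- `G_L = 1` on the `M` periods `0 ≤ x 2 ≤ L`. [folklore] -/
private theorem axialWindow_eq_one {L : ℝ} (hL : 0 < L) {x : EuclideanSpace ℝ (Fin 3)}
    (hx : 0 ≤ x 2 ∧ x 2 ≤ L) : axialWindow L x = 1 :=
  gentleWindow_eq_one ⟨div_nonneg hx.1 hL.le, (div_le_one hL).2 hx.2⟩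

/-- `G_L(x) ≠ 0` forces `-L < x 2 < 2L`. [folklore] -/
private theorem mem_Ioo_of_axialWindow_ne_zero {L : ℝ} (hL : 0 < L) {x : EuclideanSpace ℝ (Fin 3)}
    (hx : axialWindow L x ≠ 0) : -L < x 2 ∧ x 2 < 2 * L := by
  have h := mem_Ioo_of_gentleWindow_ne_zero hx
  constructor
  · have := h.1; rw [lt_div_iff₀ hL] at this; linarith
  · have := h.2; rw [div_lt_iff₀ hL] at this; linarith

/-- `|G_L| ≤ 1`. [folklore] -/
private theorem abs_axialWindow_le_one (L : ℝ) (x : EuclideanSpace ℝ (Fin 3)) :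
    |axialWindow L x| ≤ 1 := by
  rw [axialWindow, abs_of_nonneg (gentleWindow_nonneg _)]
  exact gentleWindow_le_one _

/-- The derivative of `G_L`: `‖DG_L(x)‖ ≤ |g₀'(x 2/L)| / L` (`L > 0`). [folklore] -/
private theorem norm_fderiv_axialWindow_le {L : ℝ} (hL : 0 < L) (x : EuclideanSpace ℝ (Fin 3)) :
    ‖fderiv ℝ (axialWindow L) x‖ ≤ |deriv gentleWindow (x 2 / L)| / L := by
  -- `G_L = g₀ ∘ ℓ`, `ℓ = L⁻¹ • proj₂`
  set ℓ : EuclideanSpace ℝ (Fin 3) →L[ℝ] ℝ := L⁻¹ • EuclideanSpace.proj (𝕜 := ℝ) (2 : Fin 3) with hℓ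
  have hℓx : ∀ y : EuclideanSpace ℝ (Fin 3), ℓ y = y 2 / L := fun y => by
    show (L⁻¹ • EuclideanSpace.proj (𝕜 := ℝ) (2 : Fin 3)) y = y 2 / L
    rw [_root_.smul_apply, smul_eq_mul, div_eq_inv_mul]
    rfl
  have hfun : axialWindow L = fun y => gentleWindow (ℓ y) := funext fun y => by rw [hℓx]; rfl
  have hg : HasDerivAt gentleWindow (deriv gentleWindow (ℓ x)) (ℓ x) :=
    ((contDiff_gentleWindow (n := 1)).differentiable one_ne_zero _).hasDerivAt
  have hcomp : HasFDerivAt (fun y => gentleWindow (ℓ y)) (deriv gentleWindow (ℓ x) • ℓ) x :=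
    hg.comp_hasFDerivAt x ℓ.hasFDerivAt
  rw [hfun, hcomp.fderiv, norm_smul, Real.norm_eq_abs, hℓx, div_eq_mul_inv]
  refine mul_le_mul_of_nonneg_left ?_ (abs_nonneg _)
  -- `‖L⁻¹ • proj₂‖ ≤ L⁻¹`
  refine ContinuousLinearMap.opNorm_le_bound _ (inv_nonneg.2 hL.le) fun y => ?_
  rw [hℓx, Real.norm_eq_abs, abs_div, abs_of_pos hL, div_eq_inv_mul]
  exact mul_le_mul_of_nonneg_left (abs_apply_two_le_norm' y) (inv_nonneg.2 hL.le)

/-- `‖DG_L‖ ≤ C₀/L`, and `DG_L = 0` wherever `G_L = 0` (zeros of `g₀` are minima). [folklore] -/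
private theorem fderiv_axialWindow_bound {L : ℝ} (hL : 0 < L) {C₀ : ℝ}
    (hC₀ : ∀ s, |deriv gentleWindow s| ≤ C₀) (x : EuclideanSpace ℝ (Fin 3)) :
    ‖fderiv ℝ (axialWindow L) x‖ ≤ C₀ / L ∧
      (axialWindow L x = 0 → fderiv ℝ (axialWindow L) x = 0) := by
  refine ⟨(norm_fderiv_axialWindow_le hL x).trans (div_le_div_of_nonneg_right (hC₀ _) hL.le),
    fun h0 => ?_⟩
  have h := norm_fderiv_axialWindow_le hL x
  rw [deriv_gentleWindow_eq_zero_of_eq_zero h0, abs_zero, zero_div] at h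
  exact norm_le_zero_iff.1 h

/-! ### The slab Sobolev inequality -/

/-- **The slab Sobolev inequality (Lei–Ren–Zhang 2019, (2.9), `L⁶` form at scale).** There is an
absolute constant `C₀ > 0` such that: for every period `P > 0`, every number of periods `M ≥ 1`,
and every `f ∈ C¹(ℝ³)` that is axially `P`-periodic and vanishes outside some cylinder
`{r < R₀}`, with `slab = zSlab P 0` (one period) and `C_S` the constant of `H¹(ℝ³) ⊂ L⁶(ℝ³)`,
`(∫_{slab} |f|⁶)^{1/3} ≤ 6 M^{2/3} C_S² (∫_{slab} ‖∇f‖² + (C₀/(MP))² ∫_{slab} f²)`.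
Printed (arXiv p. 6): "`‖f‖_{L³(D_1)} ≤ C‖∇f‖_{L²(D_1)}` for any `f` having period `Z₀` in `z`
and compactly supported in the other two dimensions", proved by applying the whole-space
embedding to `f g` with `g` a cut-off over `N` periods; here the same device with `M` periods
and the embedding into `L⁶`, the zeroth-order term being kept instead of absorbed (the
parabolic application pays for it with the time window). [cite: LeiRenZhang2019, §2 (2.9) and its proof (arXiv pp. 5–6)] -/
theorem exists_rpow_third_lintegral_six_slab_le :
    ∃ C₀ : ℝ, 0 < C₀ ∧ ∀ ⦃P : ℝ⦄, 0 < P → ∀ ⦃M : ℕ⦄, 1 ≤ M →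
      ∀ ⦃f : EuclideanSpace ℝ (Fin 3) → ℝ⦄, ContDiff ℝ 1 f → IsAxiallyPeriodic P f →
      ∀ ⦃R₀ : ℝ⦄, (∀ x, R₀ ≤ cylRadius x → f x = 0) →
        (∫⁻ x in zSlab P 0, ‖f x‖ₑ ^ (6 : ℝ)) ^ (1 / 3 : ℝ) ≤
          6 * (M : ℝ≥0∞) ^ (2 / 3 : ℝ) *
            (SNormLESNormFDerivOfEqConst ℝ (volume : Measure (EuclideanSpace ℝ (Fin 3))) 2 : ℝ≥0∞) ^ 2 *
            ((∫⁻ x in zSlab P 0, ‖fderiv ℝ f x‖ₑ ^ 2) +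
              ENNReal.ofReal ((C₀ / (M * P)) ^ 2) * ∫⁻ x in zSlab P 0, ‖f x‖ₑ ^ 2) := by
  obtain ⟨C₀, hC₀, hC⟩ := exists_abs_deriv_gentleWindow_le
  refine ⟨C₀, hC₀, ?_⟩
  intro P hP M hM f hf hper R₀ hsupp
  set CS : ℝ≥0∞ := (SNormLESNormFDerivOfEqConst ℝ (volume : Measure (EuclideanSpace ℝ (Fin 3))) 2 :
    ℝ≥0∞) with hCS
  have hM0 : (0 : ℝ) < M := by exact_mod_cast hM
  set L : ℝ := M * P with hL
  have hL0 : 0 < L := mul_pos hM0 hP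
  -- the truncated function `h = f · G_L`
  set h : EuclideanSpace ℝ (Fin 3) → ℝ := fun x => f x * axialWindow L x with hh
  have hhC : ContDiff ℝ 1 h := hf.mul (contDiff_axialWindow L)
  have hhsupp : ∀ x, h x ≠ 0 → ‖x‖ ≤ max R₀ 0 + 2 * L := by
    intro x hx
    have hf0 : f x ≠ 0 := fun h0 => hx (by simp only [hh, h0, zero_mul])
    have hG0 : axialWindow L x ≠ 0 := fun h0 => hx (by simp only [hh, h0, mul_zero])
    have hr : cylRadius x < R₀ := by
      by_contra hle; exact hf0 (hsupp x (not_lt.1 hle))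
    have hz := mem_Ioo_of_axialWindow_ne_zero hL0 hG0
    have hz' : |x 2| ≤ 2 * L := abs_le.2 ⟨by linarith [hz.1], hz.2.le⟩
    calc ‖x‖ ≤ cylRadius x + |x 2| := norm_le_cylRadius_add_abs x
      _ ≤ max R₀ 0 + 2 * L := add_le_add (hr.le.trans (le_max_left _ _)) hz'
  have hhcs : HasCompactSupport h :=
    HasCompactSupport.intro (isCompact_closedBall (0 : EuclideanSpace ℝ (Fin 3)) (max R₀ 0 + 2 * L))
      fun x hx => by
        by_contra hne
        exact hx (Metric.mem_closedBall.2 (by rw [dist_zero_right]; exact hhsupp x hne))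
  have hh2 : eLpNorm h 2 (volume : Measure (EuclideanSpace ℝ (Fin 3))) < ∞ :=
    (hhC.continuous.memLp_of_hasCompactSupport hhcs).eLpNorm_lt_top
  have hE : Module.finrank ℝ (EuclideanSpace ℝ (Fin 3)) = 3 := by simp
  -- the whole-space Sobolev inequality for `h`, squared
  have hsob : (∫⁻ x, ‖h x‖ₑ ^ (6 : ℝ)) ^ (1 / 3 : ℝ) ≤ CS ^ 2 * ∫⁻ x, ‖fderiv ℝ h x‖ₑ ^ 2 := by
    rw [LeiZhang2011.lintegral_enorm_rpow_six_rpow_third]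
    have h1 := eLpNorm_six_le_eLpNorm_fderiv_two volume hE hhC hh2
    calc eLpNorm h 6 volume ^ 2 ≤ (CS * eLpNorm (fderiv ℝ h) 2 volume) ^ 2 := pow_le_pow_left' h1 2
      _ = CS ^ 2 * ∫⁻ x, ‖fderiv ℝ h x‖ₑ ^ 2 := by
          rw [mul_pow, LeiZhang2011.eLpNorm_two_sq_eq_lintegral]
  -- periodic densities
  have hper6 : IsAxiallyPeriodic P fun x => (‖f x‖ₑ ^ (6 : ℝ) : ℝ≥0∞) := fun x => by
    simp only [hper x]
  have hper2 : IsAxiallyPeriodic P fun x => (‖f x‖ₑ ^ 2 : ℝ≥0∞) := fun x => by simp only [hper x]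
  have hperD : IsAxiallyPeriodic P fun x => (‖fderiv ℝ f x‖ₑ ^ 2 : ℝ≥0∞) := fun x => by
    simp only [hper.fderiv_periodic x]
  -- lower bound: `M` periods of `f`
  have hlow : (M : ℝ≥0∞) * ∫⁻ x in zSlab P 0, ‖f x‖ₑ ^ (6 : ℝ) ≤ ∫⁻ x, ‖h x‖ₑ ^ (6 : ℝ) := by
    have hU := hper6.setLIntegral_slabs_eq_mul hP 0 M
    simp only [Int.cast_zero, zero_mul, zero_add] at hU
    rw [← hU]
    calc ∫⁻ x in {x : EuclideanSpace ℝ (Fin 3) | 0 ≤ x 2 ∧ x 2 < (M : ℝ) * P}, ‖f x‖ₑ ^ (6 : ℝ)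
        = ∫⁻ x in {x : EuclideanSpace ℝ (Fin 3) | 0 ≤ x 2 ∧ x 2 < (M : ℝ) * P}, ‖h x‖ₑ ^ (6 : ℝ) := by
          refine setLIntegral_congr_fun
            ((measurableSet_Ici.preimage measurable_apply_two').inter
              (measurableSet_Iio.preimage measurable_apply_two')) fun x hx => ?_
          have hG : axialWindow L x = 1 := axialWindow_eq_one hL0 ⟨hx.1, by rw [hL]; exact hx.2.le⟩
          simp only [hh, hG, mul_one]
      _ ≤ ∫⁻ x, ‖h x‖ₑ ^ (6 : ℝ) := setLIntegral_le_lintegral _ _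
  -- upper bound: the gradient of `h` lives on `3M` periods
  set V : Set (EuclideanSpace ℝ (Fin 3)) := {x | ((-(M : ℤ) : ℤ) : ℝ) * P ≤ x 2 ∧
      x 2 < (((-(M : ℤ) : ℤ) : ℝ) + ((3 * M : ℕ) : ℝ)) * P} with hVdef
  have hVm : MeasurableSet V :=
    (measurableSet_Ici.preimage measurable_apply_two').inter
      (measurableSet_Iio.preimage measurable_apply_two')
  have hV : ∀ x, ‖fderiv ℝ h x‖ₑ ^ 2 ≤
      V.indicator (fun x => 2 * (‖fderiv ℝ f x‖ₑ ^ 2 + ENNReal.ofReal ((C₀ / L) ^ 2) * ‖f x‖ₑ ^ 2)) x := by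
    intro x
    have hfd : DifferentiableAt ℝ f x := (hf.differentiable one_ne_zero) x
    have hGd : DifferentiableAt ℝ (axialWindow L) x :=
      ((contDiff_axialWindow L (n := 1)).differentiable one_ne_zero) x
    have hprod : fderiv ℝ h x = f x • fderiv ℝ (axialWindow L) x + axialWindow L x • fderiv ℝ f x := by
      simp only [hh]
      rw [fderiv_fun_mul hfd hGd]
    obtain ⟨hGb, hG0⟩ := fderiv_axialWindow_bound hL0 hC x
    by_cases hx : -L < x 2 ∧ x 2 < 2 * L
    · -- inside the `3M` periods
      have hmem : x ∈ V := by
        simp only [hVdef, mem_setOf_eq, Int.cast_neg, Int.cast_natCast, Nat.cast_mul, Nat.cast_ofNat]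
        constructor <;> nlinarith [hx.1, hx.2, hL]
      rw [indicator_of_mem hmem]
      have hn : ‖fderiv ℝ h x‖ ≤ |f x| * (C₀ / L) + ‖fderiv ℝ f x‖ := by
        rw [hprod]
        refine (norm_add_le _ _).trans (add_le_add ?_ ?_)
        · rw [norm_smul, Real.norm_eq_abs]
          exact mul_le_mul_of_nonneg_left hGb (abs_nonneg _)
        · rw [norm_smul, Real.norm_eq_abs]
          calc |axialWindow L x| * ‖fderiv ℝ f x‖ ≤ 1 * ‖fderiv ℝ f x‖ :=
                mul_le_mul_of_nonneg_right (abs_axialWindow_le_one L x) (norm_nonneg _)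
            _ = ‖fderiv ℝ f x‖ := one_mul _
      have hsq : ‖fderiv ℝ h x‖ ^ 2 ≤ 2 * (‖fderiv ℝ f x‖ ^ 2 + (C₀ / L) ^ 2 * |f x| ^ 2) := by
        have ha : 0 ≤ |f x| * (C₀ / L) := mul_nonneg (abs_nonneg _) (div_nonneg hC₀.le hL0.le)
        nlinarith [hn, norm_nonneg (fderiv ℝ h x), norm_nonneg (fderiv ℝ f x),
          sq_nonneg (|f x| * (C₀ / L) - ‖fderiv ℝ f x‖)]
      have e1 : (‖fderiv ℝ h x‖ₑ ^ 2 : ℝ≥0∞) = ENNReal.ofReal (‖fderiv ℝ h x‖ ^ 2) := by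
        rw [← ofReal_norm, ENNReal.ofReal_pow (norm_nonneg _)]
      have ea : (‖fderiv ℝ f x‖ₑ ^ 2 : ℝ≥0∞) = ENNReal.ofReal (‖fderiv ℝ f x‖ ^ 2) := by
        rw [← ofReal_norm, ENNReal.ofReal_pow (norm_nonneg _)]
      have eb : (‖f x‖ₑ ^ 2 : ℝ≥0∞) = ENNReal.ofReal (|f x| ^ 2) := by
        rw [Real.enorm_eq_ofReal_abs, ENNReal.ofReal_pow (abs_nonneg _)]
      rw [e1, ea, eb]
      calc ENNReal.ofReal (‖fderiv ℝ h x‖ ^ 2)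
          ≤ ENNReal.ofReal (2 * (‖fderiv ℝ f x‖ ^ 2 + (C₀ / L) ^ 2 * |f x| ^ 2)) :=
            ENNReal.ofReal_le_ofReal hsq
        _ = 2 * (ENNReal.ofReal (‖fderiv ℝ f x‖ ^ 2) +
              ENNReal.ofReal ((C₀ / L) ^ 2) * ENNReal.ofReal (|f x| ^ 2)) := by
            rw [ENNReal.ofReal_mul (by norm_num : (0 : ℝ) ≤ 2), ENNReal.ofReal_ofNat,
              ENNReal.ofReal_add (sq_nonneg _) (by positivity), ENNReal.ofReal_mul (sq_nonneg _)]
    · -- outside: `G_L = 0` and `DG_L = 0`, so `Dh = 0`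
      have hGz : axialWindow L x = 0 := by
        by_contra hne; exact hx (mem_Ioo_of_axialWindow_ne_zero hL0 hne)
      have hDz : fderiv ℝ h x = 0 := by
        rw [hprod, hGz, hG0 hGz, smul_zero, zero_smul, add_zero]
      rw [hDz]
      calc (‖(0 : EuclideanSpace ℝ (Fin 3) →L[ℝ] ℝ)‖ₑ ^ 2 : ℝ≥0∞) = 0 := by
            rw [← ofReal_norm, norm_zero, ENNReal.ofReal_zero, zero_pow two_ne_zero]
        _ ≤ _ := zero_le
  have hm1 : Measurable fun x : EuclideanSpace ℝ (Fin 3) => (‖fderiv ℝ f x‖ₑ ^ 2 : ℝ≥0∞) :=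
    (hf.continuous_fderiv one_ne_zero).measurable.enorm.pow_const _
  have hm2 : Measurable fun x : EuclideanSpace ℝ (Fin 3) => (‖f x‖ₑ ^ 2 : ℝ≥0∞) :=
    hf.continuous.measurable.enorm.pow_const _
  have hup : ∫⁻ x, ‖fderiv ℝ h x‖ₑ ^ 2 ≤
      2 * (((3 * M : ℕ) : ℝ≥0∞) * ((∫⁻ x in zSlab P 0, ‖fderiv ℝ f x‖ₑ ^ 2) +
        ENNReal.ofReal ((C₀ / L) ^ 2) * ∫⁻ x in zSlab P 0, ‖f x‖ₑ ^ 2)) := by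
    calc ∫⁻ x, ‖fderiv ℝ h x‖ₑ ^ 2
        ≤ ∫⁻ x, V.indicator
            (fun x => 2 * (‖fderiv ℝ f x‖ₑ ^ 2 + ENNReal.ofReal ((C₀ / L) ^ 2) * ‖f x‖ₑ ^ 2)) x :=
          lintegral_mono hV
      _ = ∫⁻ x in V, 2 * (‖fderiv ℝ f x‖ₑ ^ 2 + ENNReal.ofReal ((C₀ / L) ^ 2) * ‖f x‖ₑ ^ 2) :=
          lintegral_indicator hVm _
      _ = 2 * ((∫⁻ x in V, ‖fderiv ℝ f x‖ₑ ^ 2) +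
            ENNReal.ofReal ((C₀ / L) ^ 2) * ∫⁻ x in V, ‖f x‖ₑ ^ 2) := by
          have hm12 : Measurable fun x : EuclideanSpace ℝ (Fin 3) =>
              (‖fderiv ℝ f x‖ₑ ^ 2 + ENNReal.ofReal ((C₀ / L) ^ 2) * ‖f x‖ₑ ^ 2 : ℝ≥0∞) :=
            hm1.add (measurable_const.mul hm2)
          rw [lintegral_const_mul _ hm12, lintegral_add_left hm1, lintegral_const_mul _ hm2]
      _ = 2 * (((3 * M : ℕ) : ℝ≥0∞) * ((∫⁻ x in zSlab P 0, ‖fderiv ℝ f x‖ₑ ^ 2) +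
            ENNReal.ofReal ((C₀ / L) ^ 2) * ∫⁻ x in zSlab P 0, ‖f x‖ₑ ^ 2)) := by
          rw [hVdef, hperD.setLIntegral_slabs_eq_mul hP, hper2.setLIntegral_slabs_eq_mul hP]
          ring
  -- assemble: `M^{1/3} A₆^{1/3} ≤ CS² · 6M · (…)`
  have hMne : (M : ℝ≥0∞) ≠ 0 := by exact_mod_cast (show (M : ℕ) ≠ 0 by omega)
  have hMtop : (M : ℝ≥0∞) ≠ ∞ := ENNReal.natCast_ne_top M
  have hM3 : (M : ℝ≥0∞) ^ (1 / 3 : ℝ) ≠ 0 := (ENNReal.rpow_pos (pos_iff_ne_zero.2 hMne) hMtop).ne'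
  have hM3' : (M : ℝ≥0∞) ^ (1 / 3 : ℝ) ≠ ∞ := ENNReal.rpow_ne_top_of_nonneg (by norm_num) hMtop
  have hsplit : (M : ℝ≥0∞) = (M : ℝ≥0∞) ^ (1 / 3 : ℝ) * (M : ℝ≥0∞) ^ (2 / 3 : ℝ) := by
    rw [← ENNReal.rpow_add _ _ hMne hMtop]
    norm_num
  set X : ℝ≥0∞ := (∫⁻ x in zSlab P 0, ‖fderiv ℝ f x‖ₑ ^ 2) +
    ENNReal.ofReal ((C₀ / L) ^ 2) * ∫⁻ x in zSlab P 0, ‖f x‖ₑ ^ 2 with hX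
  have hmain : (M : ℝ≥0∞) ^ (1 / 3 : ℝ) * (∫⁻ x in zSlab P 0, ‖f x‖ₑ ^ (6 : ℝ)) ^ (1 / 3 : ℝ) ≤
      (M : ℝ≥0∞) ^ (1 / 3 : ℝ) * (6 * (M : ℝ≥0∞) ^ (2 / 3 : ℝ) * CS ^ 2 * X) :=
    calc (M : ℝ≥0∞) ^ (1 / 3 : ℝ) * (∫⁻ x in zSlab P 0, ‖f x‖ₑ ^ (6 : ℝ)) ^ (1 / 3 : ℝ)
        = ((M : ℝ≥0∞) * ∫⁻ x in zSlab P 0, ‖f x‖ₑ ^ (6 : ℝ)) ^ (1 / 3 : ℝ) := by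
          rw [ENNReal.mul_rpow_of_nonneg _ _ (by norm_num : (0 : ℝ) ≤ 1 / 3)]
      _ ≤ (∫⁻ x, ‖h x‖ₑ ^ (6 : ℝ)) ^ (1 / 3 : ℝ) := ENNReal.rpow_le_rpow hlow (by norm_num)
      _ ≤ CS ^ 2 * ∫⁻ x, ‖fderiv ℝ h x‖ₑ ^ 2 := hsob
      _ ≤ CS ^ 2 * (2 * (((3 * M : ℕ) : ℝ≥0∞) * X)) := mul_le_mul_of_nonneg_left hup zero_le
      _ = (M : ℝ≥0∞) ^ (1 / 3 : ℝ) * (6 * (M : ℝ≥0∞) ^ (2 / 3 : ℝ) * CS ^ 2 * X) := by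
          rw [Nat.cast_mul, Nat.cast_ofNat]
          conv_lhs => rw [hsplit]
          ring
  exact (ENNReal.mul_le_mul_iff_right hM3 hM3').1 hmain

/-! ### The parabolic `L^{10/3}` interpolation per period -/

/-- **The Sobolev step of the Moser iteration per period** (Lei–Ren–Zhang 2019, proof of
Lemma 2.1: "Interpolation of (2.8) gives …"; the tree's whole-space form is
`LeiZhang2011.lintegral_rpow_tenThirds_le_of_slice_bounds`). There is an absolute `C₀ > 0` such
that: for `P > 0`, `M ≥ 1`, a time measure `ν`, and a space–time function `g` whose `ν`-a.e.
slices are `C¹`, axially `P`-periodic and vanish outside some cylinder `{r < R₀}`, if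
`∫_{slab} g(s)² ≤ M*` and `∫_{slab} ‖∇g(s)‖² + (C₀/(MP))² ∫_{slab} g(s)² ≤ W(s)` for `ν`-a.e. `s`
(`W` a.e.-measurable), then
`∬ |g|^{10/3} d(ν ⊗ dx|_{slab}) ≤ 6 M^{2/3} C_S² · M*^{2/3} · ∫ W dν`. [cite: LeiRenZhang2019, §2, proof of Lemma 2.1 (interpolation of (2.8), arXiv p. 6)] -/
theorem exists_lintegral_rpow_tenThirds_slab_le :
    ∃ C₀ : ℝ, 0 < C₀ ∧ ∀ ⦃P : ℝ⦄, 0 < P → ∀ ⦃M : ℕ⦄, 1 ≤ M →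
      ∀ ⦃g : ℝ → EuclideanSpace ℝ (Fin 3) → ℝ⦄ ⦃ν : Measure ℝ⦄ ⦃R₀ : ℝ⦄,
      (∀ᵐ s ∂ν, ContDiff ℝ 1 (g s)) → (∀ᵐ s ∂ν, IsAxiallyPeriodic P (g s)) →
      (∀ᵐ s ∂ν, ∀ x, R₀ ≤ cylRadius x → g s x = 0) →
      ∀ ⦃Mstar : ℝ≥0∞⦄, (∀ᵐ s ∂ν, ∫⁻ x in zSlab P 0, ‖g s x‖ₑ ^ 2 ≤ Mstar) →
      ∀ ⦃W : ℝ → ℝ≥0∞⦄, AEMeasurable W ν →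
      (∀ᵐ s ∂ν, (∫⁻ x in zSlab P 0, ‖fderiv ℝ (g s) x‖ₑ ^ 2) +
          ENNReal.ofReal ((C₀ / (M * P)) ^ 2) * ∫⁻ x in zSlab P 0, ‖g s x‖ₑ ^ 2 ≤ W s) →
      ∫⁻ p, ‖g p.1 p.2‖ₑ ^ (10 / 3 : ℝ) ∂(ν.prod (volume.restrict (zSlab P 0))) ≤
        6 * (M : ℝ≥0∞) ^ (2 / 3 : ℝ) *
          (SNormLESNormFDerivOfEqConst ℝ (volume : Measure (EuclideanSpace ℝ (Fin 3))) 2 : ℝ≥0∞) ^ 2 *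
          Mstar ^ (2 / 3 : ℝ) * ∫⁻ s, W s ∂ν := by
  obtain ⟨C₀, hC₀, hA⟩ := exists_rpow_third_lintegral_six_slab_le
  refine ⟨C₀, hC₀, ?_⟩
  intro P hP M hM g ν R₀ hg hper hsupp Mstar hMs W hWm hW
  set CS : ℝ≥0∞ := (SNormLESNormFDerivOfEqConst ℝ (volume : Measure (EuclideanSpace ℝ (Fin 3))) 2 :
    ℝ≥0∞) with hCS
  set K : ℝ≥0∞ := 6 * (M : ℝ≥0∞) ^ (2 / 3 : ℝ) * CS ^ 2 with hK
  refine (lintegral_prod_le _).trans ?_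
  have hslice : ∀ᵐ s ∂ν, ∫⁻ x in zSlab P 0, ‖g s x‖ₑ ^ (10 / 3 : ℝ) ≤
      K * Mstar ^ (2 / 3 : ℝ) * W s := by
    filter_upwards [hg, hper, hsupp, hMs, hW] with s hgs hps hss hMss hWs
    have hmeas : AEMeasurable (fun x => ‖g s x‖ₑ) (volume.restrict (zSlab P 0)) :=
      hgs.continuous.measurable.enorm.aemeasurable
    have h1 := lintegral_rpow_tenThirds_le_Lp_interpolation (volume.restrict (zSlab P 0)) hmeas
    have h2 : (∫⁻ x in zSlab P 0, ‖g s x‖ₑ ^ (2 : ℕ)) ^ (2 / 3 : ℝ) ≤ Mstar ^ (2 / 3 : ℝ) :=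
      ENNReal.rpow_le_rpow hMss (by norm_num)
    have h3 : (∫⁻ x in zSlab P 0, ‖g s x‖ₑ ^ (6 : ℝ)) ^ (1 / 3 : ℝ) ≤ K * W s :=
      (hA hP hM hgs hps hss).trans (mul_le_mul_of_nonneg_left hWs zero_le)
    calc ∫⁻ x in zSlab P 0, ‖g s x‖ₑ ^ (10 / 3 : ℝ)
        ≤ (∫⁻ x in zSlab P 0, ‖g s x‖ₑ ^ (2 : ℕ)) ^ (2 / 3 : ℝ) *
            (∫⁻ x in zSlab P 0, ‖g s x‖ₑ ^ (6 : ℝ)) ^ (1 / 3 : ℝ) := h1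
      _ ≤ Mstar ^ (2 / 3 : ℝ) * (K * W s) := mul_le_mul' h2 h3
      _ = K * Mstar ^ (2 / 3 : ℝ) * W s := by ring
  calc ∫⁻ s, ∫⁻ x, ‖g (s, x).1 (s, x).2‖ₑ ^ (10 / 3 : ℝ) ∂(volume.restrict (zSlab P 0)) ∂ν
      ≤ ∫⁻ s, K * Mstar ^ (2 / 3 : ℝ) * W s ∂ν := lintegral_mono_ae hslice
    _ = K * Mstar ^ (2 / 3 : ℝ) * ∫⁻ s, W s ∂ν := lintegral_const_mul'' _ hWm

end Literature.Analysis.FluidPDE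

end
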